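import Literature.Geometry.ComplexAnalytic.PhamBrieskornFibreSymmetries
import HarnessLib

/-!
# The weighted rotation of the Pham–Brieskorn fibre with exponents `(2, …, 2, 4)`: order four, square = rotation of the last
# coordinate by `−1`

Layer `Literature/Geometry/ComplexAnalytic`; theorems only.  Written by the prover seat `hodge-nonav-prover-Bx` (g16, cell
`hodge-nonav`) for the final glue of the programme «A₃-TRACE» (stub hN′ `stub_a3NonCommOdd` of crux K1-B of
`Summits/HodgeConjecture/HodgeConjecture/Theses/SignSymmetricPowers.lean`, stmt-HodgeConjecture-19716): the localisation package of
`WeightedPencil.exists_localisationPackage_of_pencilMonodromy` carries Milnor's characteristic homeomorphism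
`g = R_{−2π} : zⱼ ↦ e^{−2πi/aⱼ} zⱼ` (`WeightedPencil.exists_weightedRotation_fibre`); for the `A₃` weights `aⱼ = 2` (`j ≠ last`),
`a_last = 4` this is `g(z′, z_last) = (−z′, −i·z_last)`, so `g⁴ = id` and `g² = rotateFibre a (−1)` (the rotation of the last
coordinate by `−1 ∈ Ω₄`, `−1 ≠ 1`) — the two hypotheses `hg4`, `hg2` of
`PhamBrieskornLocalisedMonodromyNotUnipotent.not_isNilpotent_sub_one_of_localisedRotation(_fiberOver)`.

## References
* [Milnor1968] J. Milnor, *Singular Points of Complex Hypersurfaces*, §9, Lemma 9.4 and p. 77 (the characteristic homeomorphism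
  `h = r_{a₁} ⊗ ⋯ ⊗ r_{aₘ}` of the fibre of a weighted-homogeneous polynomial, of finite order).
-/

noncomputable section

open Complex Set

namespace Literature.Geometry.ComplexAnalytic

namespace PhamBrieskorn

variable {m : ℕ} {a : Fin (m + 2) → ℕ}

/-- `e^{−2πi/2} = −1`. [folklore] -/
private theorem exp_neg_two_pi_div_two : Complex.exp ((((-(2 * Real.pi)) / (2 : ℕ) : ℝ) : ℂ) * I) = -1 := by
  have h : ((((-(2 * Real.pi)) / (2 : ℕ) : ℝ) : ℂ) * I) = -(Real.pi * I) := by push_cast; ring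
  rw [h, Complex.exp_neg, exp_pi_mul_I, inv_neg, inv_one]

/-- `e^{−2πi/4} = −i`. [folklore] -/
private theorem exp_neg_two_pi_div_four : Complex.exp ((((-(2 * Real.pi)) / (4 : ℕ) : ℝ) : ℂ) * I) = -I := by
  have h : ((((-(2 * Real.pi)) / (4 : ℕ) : ℝ) : ℂ) * I) = -(Real.pi / 2 * I) := by push_cast; ring
  rw [h, Complex.exp_neg, exp_pi_div_two_mul_I, Complex.inv_I]

/-- **Milnor's characteristic homeomorphism of the `A₃`-suspension fibre has order four and its square is the rotation of the last
coordinate by `−1`.**  For weights `a` with `a ⱼ.castSucc = 2` and `a last = 4` and a self-map `g` of the fibre `{Σ zⱼ^{aⱼ} = 1}`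
acting by `zⱼ ↦ e^{−2πi/aⱼ} zⱼ`: `g⁴ = id`, and `g ∘ g = rotateFibre a v` for some `v ∈ Ω_{a last}` with `v ≠ 1` (namely `v = −1`).
[cite: Milnor1968, §9 Lemma 9.4 and p. 77] -/
theorem weightedRotation_pow_four_and_sq (h2 : ∀ i : Fin (m + 1), a i.castSucc = 2) (h4 : a (Fin.last (m + 1)) = 4)
    (ha : ∀ i, a i ≠ 0) (g : C(↥(fibre a), ↥(fibre a)))
    (hg : ∀ z, ((g z : ↥(fibre a)) : Fin (m + 2) → ℂ) =
      fun j => Complex.exp ((((-(2 * Real.pi)) / a j : ℝ) : ℂ) * I) * (z : Fin (m + 2) → ℂ) j) :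
    (∀ z, g (g (g (g z))) = z) ∧
      ∃ v : Omega (a (Fin.last (m + 1))), (v : ℂ) ≠ 1 ∧ ∀ z, g (g z) = rotateFibre a ha v z := by
  -- the rotation factors
  have hc : ∀ j : Fin (m + 2), Complex.exp ((((-(2 * Real.pi)) / a j : ℝ) : ℂ) * I) =
      Fin.lastCases (motive := fun _ => ℂ) (-I) (fun _ => -1) j := by
    intro j
    refine Fin.lastCases ?_ (fun i => ?_) j
    · rw [h4, Fin.lastCases_last]; exact exp_neg_two_pi_div_four
    · rw [h2 i, Fin.lastCases_castSucc]; exact exp_neg_two_pi_div_two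
  have hg' : ∀ (z : ↥(fibre a)) (j : Fin (m + 2)), ((g z : ↥(fibre a)) : Fin (m + 2) → ℂ) j =
      Fin.lastCases (motive := fun _ => ℂ) (-I) (fun _ => -1) j * (z : Fin (m + 2) → ℂ) j := fun z j => by
    rw [hg z]
    exact congrArg (· * _) (hc j)
  have hgl : ∀ z : ↥(fibre a), ((g z : ↥(fibre a)) : Fin (m + 2) → ℂ) (Fin.last (m + 1)) =
      -I * (z : Fin (m + 2) → ℂ) (Fin.last (m + 1)) := fun z => by rw [hg', Fin.lastCases_last]
  have hgc : ∀ (z : ↥(fibre a)) (i : Fin (m + 1)), ((g z : ↥(fibre a)) : Fin (m + 2) → ℂ) i.castSucc =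
      -(z : Fin (m + 2) → ℂ) i.castSucc := fun z i => by rw [hg', Fin.lastCases_castSucc, neg_one_mul]
  refine ⟨fun z => Subtype.ext (funext fun j => ?_), ?_⟩
  · refine Fin.lastCases ?_ (fun i => ?_) j
    · rw [hgl, hgl, hgl, hgl]
      have hI4 : I ^ 4 = 1 := Complex.I_pow_four
      linear_combination ((z : Fin (m + 2) → ℂ) (Fin.last (m + 1))) * hI4
    · rw [hgc, hgc, hgc, hgc, neg_neg, neg_neg]
  · have hv : (-1 : ℂ) ∈ Omega (a (Fin.last (m + 1))) := by
      rw [mem_Omega, h4]; norm_num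
    refine ⟨⟨-1, hv⟩, by norm_num, fun z => Subtype.ext (funext fun j => ?_)⟩
    rw [rotateFibre_apply_coe]
    refine Fin.lastCases ?_ (fun i => ?_) j
    · rw [hgl, hgl, rotateFun_last]
      have hI2 : I ^ 2 = -1 := Complex.I_sq
      linear_combination ((z : Fin (m + 2) → ℂ) (Fin.last (m + 1))) * hI2
    · rw [hgc, hgc, neg_neg, rotateFun_castSucc]

end PhamBrieskorn

end Literature.Geometry.ComplexAnalytic

end
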